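/-
Copyright (c) 2026 the pub-hodgecm-mathlib formalisation cell (harness21).  Prover seat hodgecm-mathlib-LA3-p01 (g0), P6 «MOD programme», half A line L3,
organ **(v-gen)** = the currency-free STAGE LEMMA behind ★ (ν8k) §1 (LA3-plan (R1) 2026-09-02 03:30:21Z «ONE GENERAL kernel conjunct (v)»); 2026-09-02.
-/
import Literature.AlgebraicGeometry.AbelianSchemes.QuotientKernelClauseBaseChange
import Literature.AlgebraicGeometry.Limits.SeparatedSchematicExt
import HarnessLib

/-!
# A KERNEL CLAUSE AT THE SCHEMATICALLY DOMINANT POINT OF A STAGE HOLDS OVER THE WHOLE STAGE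
# (flat closed subgroups are recognised on the generic fibre; [BoschLutkebohmertRaynaud1990] §2.4–§2.5, §7.1; [EGAIV3] 11.10)

Topic `AlgebraicGeometry/AbelianSchemes`, namespace `Literature.AlgebraicGeometry.AbelianSchemes[.AbelianSchemeOver]`.  THEOREMS ONLY (no definition, no named
fact, no instance, no notation).  Cell `hodgecm-mathlib` (D-0151), F0∕P6 «MOD», organ **(v-gen)** — the general form of ★ (ν8k) `idealKernelLaw_special_of_generic`
(there `𝒦 := 𝒜′[𝔞] = Ker ψ_P`): over a stage `V′` with a quasi-compact schematically dominant point `a′ : Spec Ω → V′`, a morphism `U : 𝒜′ → 𝒞′` of abelian schemes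
with FLAT kernel and a FLAT closed `𝒦 ↪ 𝒜′` (`incl`) such that `𝒦_{a′}` carries the kernel clause of `U_{a′}` on all `T`-points (★ `QuotientKernelClauseBaseChange` currency
`(∃ s, s ≫ incl = t) ↔ t ≫ U = 1`); THEN `𝒦` carries the kernel clause of `U` over `V′`, hence (★ `exists_comp_pullback_map_iff_of_kernelClause`) after EVERY base
change `b′ : S″ → V′` — e.g. at the special point of the stage.

ROAD (no descent, no degree count): (KILL) `incl ≫ U = 1` — a morphism out of the flat `𝒦` into the separated `𝒞′`, decided after base change to `a′`
(★ `pullback_map_injective_of_flat`); (LIFT) `kerι U` factors through `incl` — the square `(Ker U)_{a′} → 𝒦 ↪ 𝒜′ ← Ker U` has a lift because `(Ker U)_{a′} → Ker U` is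
schematically dominant (`Ker U` flat, Mathlib `IsSchemeTheoreticallyDominant.pullbackFst`) and closed immersions are right-orthogonal to schematically dominant morphisms
(§1 `exists_lift_of_isClosedImmersion`, ★ `isIso_of_isClosedImmersion_of_isSchemeTheoreticallyDominant'`); KILL + LIFT + `kerLift` = the clause over `V′`.
Also the KILL-only form `comp_eq_one_of_pullback_map_comp_eq_one` (no closed immersion, no flat kernel: `incl_{a′} ≫ U_{a′} = 1 ⇒ incl ≫ U = 1`).
Consumers: the (ν8k) ROOF∕COVER kernel readings of the D-line `stub_FROB` (𝒦 := an (S-c) ideal layer, or the closure of a line in it).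

HONEST LABEL: HC_CM is proved only modulo the cell's 2 remaining named inputs (hLiu418 24832, h413 24833) until rung 0 closes; generic capital on
`--supports stmt-HodgeConjecture-24832`, pays no letter.

## References
* [BoschLutkebohmertRaynaud1990] S. Bosch, W. Lütkebohmert, M. Raynaud, *Néron Models* (1990), §2.5 Prop. 2, §7.1 Lemma 5∕Prop. 6 (pp. 174–180).
* [GortzWedhorn2020] U. Görtz, T. Wedhorn, *Algebraic Geometry I*, 2nd ed. (2020), Prop. 9.19, Rem. 9.20 (pp. 233–234); Def. 4.45 (2) (p. 117).
* [EGAIV3] A. Grothendieck, J. Dieudonné, EGA IV₃ (1966), 11.10.1–11.10.5.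
-/

set_option autoImplicit false

noncomputable section

set_option backward.isDefEq.respectTransparency false

universe u

open CategoryTheory CategoryTheory.Limits AlgebraicGeometry MonoidalCategory CartesianMonoidalCategory
open scoped MonObj
open Literature.AlgebraicGeometry.GroupSchemes.GroupSchemeKernel (ker kerι kerLift kerLift_ι kerι_comp)
open Literature.AlgebraicGeometry.Limits (pullback_map_injective_of_flat isIso_of_isClosedImmersion_of_isSchemeTheoreticallyDominant')

namespace Literature.AlgebraicGeometry.AbelianSchemes

section Lift

/-! ### §1 Closed immersions are right-orthogonal to schematically dominant morphisms -/

/-- **LIFTING AGAINST A CLOSED IMMERSION.**  A commutative square `w ≫ i = d ≫ z` with `d : W → Z` schematically dominant and `i : K ↪ X` a closed immersion has a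
(unique) lift `ℓ : Z → K`, `ℓ ≫ i = z`, `d ≫ ℓ = w`: the closed subscheme `Z ×_X K ↪ Z` is schematically dominant (it receives `d`), hence all of `Z`.
[cite: GortzWedhorn2020, Prop. 9.19 and Rem. 9.20 (pp. 233–234)] [cite: EGAIV3, 11.10.1] -/
theorem exists_lift_of_isClosedImmersion {W Z K X : Scheme.{u}} (d : W ⟶ Z) [IsSchemeTheoreticallyDominant d] (i : K ⟶ X) [IsClosedImmersion i]
    (w : W ⟶ K) (z : Z ⟶ X) (h : w ≫ i = d ≫ z) : ∃ ℓ : Z ⟶ K, ℓ ≫ i = z ∧ d ≫ ℓ = w := by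
  haveI : IsSchemeTheoreticallyDominant (pullback.lift w d h ≫ pullback.snd i z) := by
    rw [pullback.lift_snd]
    infer_instance
  haveI : IsSchemeTheoreticallyDominant (pullback.snd i z) :=
    Literature.AlgebraicGeometry.Limits.IsSchemeTheoreticallyDominant.of_comp_left (pullback.lift w d h) _
  haveI : IsClosedImmersion (pullback.snd i z) := MorphismProperty.pullback_snd _ _ inferInstance
  haveI : IsIso (pullback.snd i z) := isIso_of_isClosedImmersion_of_isSchemeTheoreticallyDominant' _
  refine ⟨inv (pullback.snd i z) ≫ pullback.fst i z, by rw [Category.assoc, pullback.condition, IsIso.inv_hom_id_assoc], ?_⟩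
  rw [show d = pullback.lift w d h ≫ pullback.snd i z from (pullback.lift_snd _ _ _).symm, Category.assoc, IsIso.hom_inv_id_assoc,
    pullback.lift_fst]

end Lift

namespace AbelianSchemeOver

section Stage

/-! ### §2 The stage lemma -/

variable {V' : Scheme.{u}} {Ω : Type u} [Field Ω] (a' : Spec (.of Ω) ⟶ V') [QuasiCompact a'] [IsSchemeTheoreticallyDominant a']
  {𝒜' 𝒞' : AbelianSchemeOver V'} (U : 𝒜'.X ⟶ 𝒞'.X) {𝒦 : Over V'} (incl : 𝒦 ⟶ 𝒜'.X) [Flat 𝒦.hom]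

/-- **KILL.**  If `incl_{a′} ≫ U_{a′} = 1` at the schematically dominant point `a′` then `incl ≫ U = 1` over `V′` (`𝒦` flat, `𝒞′` separated, ★ `pullback_map_injective_of_flat`).
[cite: EGAIV3, 11.10.5] [cite: BoschLutkebohmertRaynaud1990, §7.1 Lemma 5 (p. 176)] -/
theorem comp_eq_one_of_pullback_map_comp_eq_one (h : (Over.pullback a').map incl ≫ (Over.pullback a').map U = (1 : _ ⟶ (𝒞'.baseChange a').X)) : incl ≫ U = 1 := by
  haveI := 𝒞'.isProper
  haveI : IsSeparated 𝒞'.X.hom := inferInstance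
  have key : (Over.pullback a').map (incl ≫ U) = (Over.pullback a').map (1 : 𝒦 ⟶ 𝒞'.X) := by
    rw [Functor.map_comp, pullback_map_one]
    exact h
  exact pullback_map_injective_of_flat a' key

variable (hgen : ∀ ⦃T : Over (Spec (.of Ω))⦄ (t : T ⟶ (𝒜'.baseChange a').X),
    (∃ s : T ⟶ (Over.pullback a').obj 𝒦, s ≫ (Over.pullback a').map incl = t) ↔ t ≫ (Over.pullback a').map U = (1 : T ⟶ (𝒞'.baseChange a').X))
include hgen

/-- (KILL under the clause) `incl ≫ U = 1` over `V′`. [cite: EGAIV3, 11.10.5] -/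
theorem comp_eq_one_of_kernelClause_generic : incl ≫ U = 1 :=
  comp_eq_one_of_pullback_map_comp_eq_one a' U incl ((hgen _).1 ⟨𝟙 _, Category.id_comp _⟩)

omit [Flat 𝒦.hom] in
/-- **LIFT.**  Under the clause at `a′`, `kerι U : Ker U ↪ 𝒜′` factors through `incl` over `V′`: the square `(Ker U)_{a′} → 𝒦 ↪ 𝒜′ ← Ker U` (its top from the clause at
`t := (kerι U)_{a′}`) has a lift, `(Ker U)_{a′} → Ker U` being schematically dominant (`Ker U` flat) and `incl` a closed immersion (§1).
[cite: BoschLutkebohmertRaynaud1990, §2.5 Prop. 2 and §7.1 Prop. 6 (p. 180)] [cite: GortzWedhorn2020, Rem. 9.20] -/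
theorem exists_comp_eq_kerι_of_kernelClause_generic [Flat (ker U).hom] [IsClosedImmersion incl.left] : ∃ s₀ : ker U ⟶ 𝒦, s₀ ≫ incl = kerι U := by
  -- the clause at `t := (kerι U)_{a′}`
  have h1 : (Over.pullback a').map (kerι U) ≫ (Over.pullback a').map U = (1 : _ ⟶ (𝒞'.baseChange a').X) := by
    have h0 := congrArg (fun f => (Over.pullback a').map f) (kerι_comp U)
    simp only [Functor.map_comp] at h0
    rw [pullback_map_one] at h0
    exact h0
  obtain ⟨s, hs⟩ := (hgen _).2 h1
  -- the square on underlying schemes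
  have hsq : (s.left ≫ pullback.fst 𝒦.hom a') ≫ incl.left = pullback.fst (ker U).hom a' ≫ (kerι U).left := by
    have e3 := congrArg (fun f => CommaMorphism.left f ≫ pullback.fst 𝒜'.X.hom a') hs
    simp only [Over.comp_left, Category.assoc, Over.pullback_map_left, pullback.lift_fst] at e3
    simpa only [Category.assoc] using e3
  obtain ⟨ℓ, hℓ, -⟩ := exists_lift_of_isClosedImmersion (pullback.fst (ker U).hom a') incl.left (s.left ≫ pullback.fst 𝒦.hom a') (kerι U).left hsq
  refine ⟨Over.homMk ℓ (by rw [← Over.w incl, ← Category.assoc, hℓ, Over.w (kerι U)]), ?_⟩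
  ext : 1
  exact hℓ

/-- **THE CLAUSE OVER THE STAGE.**  `𝒦` carries the kernel clause of `U` on all `T`-points over `V′`. [cite: BoschLutkebohmertRaynaud1990, §7.1 Prop. 6 (p. 180)] -/
theorem kernelClause_of_generic [Flat (ker U).hom] [IsClosedImmersion incl.left] ⦃T : Over V'⦄ (t : T ⟶ 𝒜'.X) : (∃ s : T ⟶ 𝒦, s ≫ incl = t) ↔ t ≫ U = 1 := by
  refine ⟨?_, fun h => ?_⟩
  · rintro ⟨s, rfl⟩
    rw [Category.assoc, comp_eq_one_of_kernelClause_generic a' U incl hgen, MonObj.comp_one]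
  · obtain ⟨s₀, hs₀⟩ := exists_comp_eq_kerι_of_kernelClause_generic a' U incl hgen
    exact ⟨kerLift t h ≫ s₀, by rw [Category.assoc, hs₀, kerLift_ι]⟩

/-- **THE CLAUSE AT EVERY BASE CHANGE OF THE STAGE** (e.g. the special point): ★ `exists_comp_pullback_map_iff_of_kernelClause` on `kernelClause_of_generic`.
[cite: BoschLutkebohmertRaynaud1990, §7.1 Prop. 6 (p. 180)] [cite: GortzWedhorn2020, Definition 4.45 (2) (p. 117)] -/
theorem kernelClause_baseChange_of_generic [Flat (ker U).hom] [IsClosedImmersion incl.left] {S'' : Scheme.{u}} (b' : S'' ⟶ V') ⦃T : Over S''⦄ (t : T ⟶ (𝒜'.baseChange b').X) :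
    (∃ s : T ⟶ (Over.pullback b').obj 𝒦, s ≫ (Over.pullback b').map incl = t) ↔ t ≫ (Over.pullback b').map U = (1 : T ⟶ (𝒞'.baseChange b').X) :=
  exists_comp_pullback_map_iff_of_kernelClause b' U incl (kernelClause_of_generic a' U incl hgen) t

end Stage

end AbelianSchemeOver

end Literature.AlgebraicGeometry.AbelianSchemes

end
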